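import Summits.BirchSwinnertonDyer.Rank1Residual.Additive.X4ExoticHauptmodulSignature
import Summits.BirchSwinnertonDyer.Rank1Residual.Additive.PotentiallyOrdinaryThree
import Summits.BirchSwinnertonDyer.Rank1Residual.Additive.SubGordThree
import Literature.NumberTheory.EllipticCurves.ZywinaCMImageProofs
import Literature.NumberTheory.EllipticCurves.IsogenyHasCMProofs
import Literature.NumberTheory.EllipticCurves.NonEisensteinPrimeOfSurjective
import Literature.NumberTheory.EllipticCurves.Wuthrich2014.ThreeAdicImageSupersingularProofs
import HarnessLib

/-!
# The SHARP EXOTIC signature of X4 at `3` (Hauptmodul SIGNATURE rows, `v₃(j − 1728) = 3` exactly, no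
# junk branch) and the class-free dichotomy "`ρ̄_{E,3}` onto ⟹ `3`-adic tower, or wild with the
# signature" (cell `b2b-bsdres`, team n1011, seat p02 gen 7 — rows T-b10 / T-b11 of record; sequel of
# `X4ExoticHauptmodulSignature` p301713, whose end-state still carried the branch `v₃(j − 1728) = 0`)

HONEST FRAMING (cell `b2b-bsdres`, run/shared/lean/b2b/bsd-rank1-residual/, verbatim in every
file): the goal of the cell is to DELETE the COMBINATION-SHAPED residual classes of the
Birch–Swinnerton-Dyer formula for ALL analytic-rank `≤ 1` elliptic curves over `ℚ` — "full BSD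
formula for every rank `≤ 1` curve in class `C`" assembled STRICTLY from published theorems — so
that the rank-`≤ 1` remainder becomes exactly the CONSTRUCTION-SHAPED classes, which are TYPED
(missing-input `Prop`s), NOT attempted. This is not "finishing BSD". Team n1011 (N10 / N11, the
additive block X4 ∧ `p = 3`): research route; no claim beyond the stated classes; labels UNCHANGED;
nothing is booked. Theorems only (no definition, no named fact; every published input of the
end-state is an explicit named-fact hypothesis, as in p250513 / p251574 / p301713).

RELATION TO n1011-p14's `Additive/X4ExoticThree.lean` (p268581).  That file ALREADY proves
`ClassX4.padicValRat_j_sub_eq_three_of_not_towerSurj_three` (EXOTIC ⟹ `v₃(j − 1728) = 3`) and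
`ClassX4.towerSurj_three_of_surj_of_padicValRat_j_sub_ne`, via the semistable-twist tower off `3 ∣ j`
(p249389) and `J1728NotSurjThree`; those two statements are NOT restated here.  This file (i) reaches
the same exclusion by a different, shorter road (§1: Zywina's CM non-surjectivity + additive-p2's
unit-`j` Tate-algorithm theorem), (ii) carries it INTO the Hauptmodul-signature end-state of p301713
(§3), and (iii) adds the class-free dichotomy (§4).  It does not import `X4ExoticThree` (module not
served by the farm at the time of writing — referee A R147 'farm-stale'); the end-state is derived from
p14's `…_exoticArms_noL20` (p264500) exactly as p301713 was.

## What this file proves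

* §1 `j_ne_zero_and_j_ne_1728_of_surj` — `ρ̄_{E,p}` onto at an odd `p` ⟹ `j ∉ {0, 1728}` (both CM,
  `HasCM.of_j_eq_zero_or_1728`; a CM curve is never surjective at an odd prime, Zywina 2015
  Prop. 1.14 = tree theorem `not_hasSurjectiveModNGaloisRep_of_hasCM`);
  `j_eq_zero_or_padicValRat_j_pos_of_subW_three` — on the WILD cell (w) at `3` (`Addv`, `¬(M)`,
  `f₃ ≠ 2`): `j = 0 ∨ v₃(j) ≥ 1` (a `3`-adic unit `j ≠ 0` makes `E^{(−3)}` good at `3` — additive-p2's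
  `typeG_three_of_padicValRat_j_eq_zero` — i.e. Delbourgo's (G), which is tame:
  `condExpTwo_three_of_typeG_of_addv`); hence `one_le_padicValRat_j_sub_1728_of_subW_three` and
  `padicValRat_j_sub_1728_ne_zero_of_subW_three_of_surj`.
* §2 **`ClassX4.exotic_signature_sharp_of_not_towerSurj_three`** — the EXOTIC signature of record
  WITHOUT the dead branch: (w) ∧ `v₃(j − 1728) = 3` ∧ [`v₃(j) = V`, `9 ∣ num(j/3^V − c)`,
  `(V, c mod 9)` of Hauptmodul-SIGNATURE type] ∧ `9 ∣ ord_q j` at every prime `q ≠ 3` with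
  `ord_q j < 0`; `ClassX4.three_le_padicValRat_j_of_not_towerSurj_three` (`v₃ j ≥ 3`);
  `ClassX4.towerSurj_three_of_surj_of_padicValRat_j_lt_three` (tower on every X4 row at `3` with
  surj(3) and `v₃ j < 3`) with its Kato (12.5.2) twin.
* §3 `exotic_arms_iff_exotic_of_sharp_signature`, `exotic_iff_exotic_of_sharp_signature`, and the
  END-STATE **`x4SharpUnitFree_iff_lower_and_residues_sharp_exoticSig_noL20`** — p251574's eight-fact
  X4 end-state with the EXOTIC piece on the SIGNATURE rows ONLY (supersedes p301713's
  `…_exoticHauptmodul_noL20`, which quantified over `v₃(j − 1728) ∈ {3, 0}` with a `= 0 ∨ SIG` clause).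
* §4 the CLASS-FREE dichotomy **`towerSurj_three_or_exotic_signature`**: for EVERY globally minimal
  `E/ℚ` with `ρ̄_{E,3}` onto, either `ρ̄_{E,3ⁿ}` is onto for all `n`, or `E` is additive and WILD at
  `3` with the sharp signature (semistable at `3`: Wuthrich 2014 Lemma 20, tree theorem
  `lemma20_surjective_threeAdic_of_semistable_holds`; additive: §2, `E[3]` irreducible by surjectivity);
  corollaries `towerSurj_three_of_surj_of_padicValRat_j_sub_1728_ne_three` (no class hypothesis) and
  its Kato (12.5.2) twin.

Census reading (EVIDENCE; `HOME/b2b-bsdres-n1011-p02/f4g6/M3-KERNEL-INDEX.tsv`, rmap-2 TOWER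
CONCORDANCE RESTAMP 8): unchanged — 749 `m = 3` cells = 626 class-level Hauptmodul tower theorems +
103 per-curve instances (n1011-p10) + 20 Elkies curves tower-less modulo [Elkies2006]; this file moves
no count.  Nothing booked; X4 CONSTRUCTION-SHAPED; no label change.

References: [Zywina2015] Prop. 1.14 / 1.16; [SilvermanAEC2009] III.10.1; [SilvermanATAEC1994]
IV.9.4, IV.10.4, Table 4.1; [SerreAbelianLadic1968] IV §3.4 Lemma 3; [Wuthrich2014] Lemma 20
(p. 399); [Maier2006] Table 4; [Elkies2006] §1; [Kato2004Asterisque] (12.5.2), Thm. 14.5 (3).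
-/

noncomputable section

open scoped Classical

open WeierstrassCurve Literature.NumberTheory.EllipticCurves
  Literature.NumberTheory.EllipticCurves.ModularForms
  Literature.NumberTheory.EllipticCurves.Rank1Residual
  Literature.NumberTheory.EllipticCurves.Rank1Residual.Typed
  Summit.BirchSwinnertonDyer.Rank1Residual.GaloisImage

namespace Summit.BirchSwinnertonDyer.Rank1Residual.Additive

/-! ### §1 Curve-level lemmas: `j ∉ {0, 1728}` under surj(p); `v₃(j) ≥ 1` on the wild cell -/

section Curve

variable {W : WeierstrassCurve ℚ} [W.IsElliptic]

/-- **`ρ̄_{E,p}` onto at an odd prime `p` ⟹ `j(E) ≠ 0` and `j(E) ≠ 1728`**: both are CM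
`j`-invariants (Silverman *AEC* III.10.1), and a CM curve has non-surjective mod-`ℓ` image at every
odd `ℓ` (Zywina 2015, Prop. 1.14; Serre 1972, §4.5). [cite: Zywina2015, Prop. 1.14 and Prop. 1.16 (§1.9)]
[cite: SilvermanAEC2009, Thm. III.10.1] -/
theorem j_ne_zero_and_j_ne_1728_of_surj {p : ℕ} [Fact p.Prime] (hp2 : p ≠ 2) (hsurj : Surj W p) :
    W.j ≠ 0 ∧ W.j ≠ 1728 := by
  have hp : p.Prime := Fact.out
  have key : ¬ (W.j = 0 ∨ W.j = 1728) := fun h ↦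
    W.not_hasSurjectiveModNGaloisRep_of_hasCM (WeierstrassCurve.HasCM.of_j_eq_zero_or_1728 h) hp hp2
      hsurj
  exact ⟨fun h ↦ key (Or.inl h), fun h ↦ key (Or.inr h)⟩

variable [W.IsGloballyMinimal]

/-- **On the wild cell (w) at `3`, `j = 0` or `v₃(j) ≥ 1`.**  (w) means `ord₃ j ≥ 0` and `f₃ ≠ 2`;
were `j` a `3`-adic unit `≠ 0`, the twist `E^{(−3)}` would be GOOD at `3` (additive-p2's
Tate-algorithm theorem `typeG_three_of_padicValRat_j_eq_zero`: Delbourgo's (G)), and (G) is tame,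
`f₃ = 2` (`condExpTwo_three_of_typeG_of_addv`). In print: inertia acts through `Aut Ẽ`, of order
`2` when `j̃ ≠ 0 = 1728` in characteristic `3`. [cite: SilvermanATAEC1994, IV.10.4 and Table 4.1 (PDF p. 365)] -/
theorem j_eq_zero_or_padicValRat_j_pos_of_subW_three [Fact (Nat.Prime 3)] (hadd : Addv W 3)
    (hS : SubW W 3) : W.j = 0 ∨ 0 < padicValRat 3 W.j := by
  have hj : 0 ≤ padicValRat 3 W.j := by
    have h := hS.1
    unfold PotMult at h
    exact not_lt.mp h
  by_cases hj0 : W.j = 0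
  · exact Or.inl hj0
  · refine Or.inr (lt_of_le_of_ne hj fun h0 ↦ ?_)
    have hG : TypeG W 3 := typeG_three_of_padicValRat_j_eq_zero W hadd hj0 h0.symm
    exact hS.2 (condExpTwo_three_of_typeG_of_addv W hG hadd)

/-- **On the wild cell (w) at `3`, `j ≠ 1728` ⟹ `v₃(j − 1728) ≥ 1`** (`j = 0`: `v₃(−1728) = 3`;
else `v₃(j − 1728) ≥ min(v₃ j, v₃ 1728) ≥ 1`). [cite: SilvermanATAEC1994, IV.10.4 and Table 4.1 (PDF p. 365)] -/
theorem one_le_padicValRat_j_sub_1728_of_subW_three [Fact (Nat.Prime 3)] (hadd : Addv W 3)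
    (hS : SubW W 3) (h1728 : W.j ≠ 1728) : 1 ≤ padicValRat 3 (W.j - 1728) := by
  rcases j_eq_zero_or_padicValRat_j_pos_of_subW_three hadd hS with h0 | hpos
  · rw [h0, zero_sub, padicValRat.neg, padicValRat_three_1728]
    norm_num
  · have hne : W.j + (-1728) ≠ 0 := by
      intro h
      exact h1728 (by linear_combination h)
    have hmin := padicValRat.min_le_padicValRat_add (p := 3) hne
    rw [← sub_eq_add_neg] at hmin
    rw [padicValRat.neg, padicValRat_three_1728] at hmin
    have h1 : (1 : ℤ) ≤ min (padicValRat 3 W.j) 3 := le_min (by omega) (by norm_num)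
    exact h1.trans hmin

/-- **On the wild cell (w) at `3` with `ρ̄_{E,3}` onto, `v₃(j − 1728) ≠ 0`** (surj(3) excludes
`j = 1728`, §1). [cite: Zywina2015, Prop. 1.14 and Prop. 1.16 (§1.9)] [cite: SilvermanATAEC1994, IV.10.4 and Table 4.1 (PDF p. 365)] -/
theorem padicValRat_j_sub_1728_ne_zero_of_subW_three_of_surj [Fact (Nat.Prime 3)] (hadd : Addv W 3)
    (hS : SubW W 3) (hsurj : Surj W 3) : padicValRat 3 (W.j - 1728) ≠ 0 := by
  have h := one_le_padicValRat_j_sub_1728_of_subW_three hadd hS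
    (j_ne_zero_and_j_ne_1728_of_surj (by decide) hsurj).2
  omega

end Curve

/-! ### §2 Class level: the sharp signature; `v₃(j) ≥ 3`; the tower below it -/

section ClassLevel

variable {W : WeierstrassCurve ℚ} [W.IsElliptic] [W.IsGloballyMinimal]

/-- **THE SHARP EXOTIC SIGNATURE OF X4 AT `3`.**  An X4 pair at `3` with `ρ̄_{E,3}` onto whose
`3`-adic tower fails is in the wild cell (w), has `v₃(j − 1728) = 3` (the `= 0` alternative of
p264500 / p301713 is empty by §1; of record also in n1011-p14's `X4ExoticThree`, p268581), has
`v₃(j) = V`, `j/3^V ≡ c (mod 9)` with `(V, c mod 9)` of Hauptmodul-SIGNATURE type (T-b11-F4-END),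
and `9 ∣ ord_q j` at every prime `q ≠ 3` with `ord_q j < 0` (ARM B).
[cite: SerreAbelianLadic1968, Ch. IV §3.4, Lemma 3 (IV-23)] [cite: Maier2006, Table 4 (N = 3, 9) and §5]
[cite: Wuthrich2014, Lemma 20 (p. 399)] [cite: Elkies2006, §1] [cite: Zywina2015, Prop. 1.14 and Prop. 1.16 (§1.9)] -/
theorem ClassX4.exotic_signature_sharp_of_not_towerSurj_three [Fact (Nat.Prime 3)]
    (hX : ClassX4 W 3) (hsurj : Surj W 3) (hnot : ¬ ∀ n : ℕ, W.HasSurjectiveModNGaloisRep (3 ^ n : ℕ)) :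
    SubW W 3 ∧ padicValRat 3 (W.j - 1728) = 3 ∧
    (∃ (V : ℕ) (c : ℤ), padicValRat 3 W.j = V ∧ (9 : ℤ) ∣ (W.j / 3 ^ V - c).num ∧
        ((V = 3 ∧ c % 9 = 8) ∨
         (6 ≤ V ∧ V % 3 = 0 ∧ (c % 9 = 1 ∨ c % 9 = 8)) ∨
         (V = 7 ∧ (c % 9 = 2 ∨ c % 9 = 4)) ∨
         (8 ≤ V ∧ V % 3 ≠ 0 ∧ (c % 9 = 1 ∨ c % 9 = 8)))) ∧
    ∀ q : ℕ, q.Prime → q ≠ 3 → padicValRat q W.j < 0 → (9 : ℤ) ∣ padicValRat q W.j := by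
  obtain ⟨hS, harm, hsig, h9⟩ := ClassX4.exotic_hauptmodul_signature_of_not_towerSurj_three hX hsurj hnot
  have h0 := padicValRat_j_sub_1728_ne_zero_of_subW_three_of_surj hX.2.1 hS hsurj
  exact ⟨hS, harm.resolve_right h0, hsig.resolve_left h0, h9⟩

/-- **X4 at `3`, `ρ̄_{E,3}` onto, tower fails ⟹ `v₃(j) ≥ 3`** (`v₃(j − 1728) = 3`, `j ≠ 0` by
surj(3), and `v₃ j ≥ min(v₃(j − 1728), v₃ 1728) = 3`). [cite: SerreAbelianLadic1968, Ch. IV §3.4, Lemma 3 (IV-23)]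
[cite: Wuthrich2014, Lemma 20 (p. 399)] -/
theorem ClassX4.three_le_padicValRat_j_of_not_towerSurj_three [Fact (Nat.Prime 3)]
    (hX : ClassX4 W 3) (hsurj : Surj W 3) (hnot : ¬ ∀ n : ℕ, W.HasSurjectiveModNGaloisRep (3 ^ n : ℕ)) :
    3 ≤ padicValRat 3 W.j := by
  have h3 := (ClassX4.exotic_signature_sharp_of_not_towerSurj_three hX hsurj hnot).2.1
  have hj0 : W.j ≠ 0 := (j_ne_zero_and_j_ne_1728_of_surj (by decide) hsurj).1
  have hne : (W.j - 1728) + 1728 ≠ 0 := by rwa [sub_add_cancel]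
  have hmin := padicValRat.min_le_padicValRat_add (p := 3) hne
  rw [sub_add_cancel, h3, padicValRat_three_1728, min_self] at hmin
  exact hmin

/-- **The tower on every X4 row at `3` with surj(3) and `v₃(j) < 3`** (e.g. `v₃ j ∈ {0, 1, 2}` or
`ord₃ j < 0`). [cite: SerreAbelianLadic1968, Ch. IV §3.4, Lemma 3 (IV-23)] [cite: Wuthrich2014, Lemma 20 (p. 399)] -/
theorem ClassX4.towerSurj_three_of_surj_of_padicValRat_j_lt_three [Fact (Nat.Prime 3)]
    (hX : ClassX4 W 3) (hsurj : Surj W 3) (hlt : padicValRat 3 W.j < 3) (n : ℕ) :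
    W.HasSurjectiveModNGaloisRep (3 ^ n : ℕ) := by
  by_contra h
  have h3 := ClassX4.three_le_padicValRat_j_of_not_towerSurj_three hX hsurj fun hall ↦ h (hall n)
  exact absurd hlt (not_lt.mpr h3)

/-- **Kato's (12.5.2) at `3`** on every X4 row with surj(3) and `v₃(j) < 3`.
[cite: Kato2004Asterisque, (12.5.2) (p. 222)] [cite: Wuthrich2014, Lemma 20 (p. 399)] -/
theorem ClassX4.imageContainsSL2_three_of_surj_of_padicValRat_j_lt_three [Fact (Nat.Prime 3)]
    (hX : ClassX4 W 3) (hsurj : Surj W 3) (hlt : padicValRat 3 W.j < 3) :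
    Kato2004.ImageContainsSL2 W 3 :=
  (Kato2004.imageContainsSL2_iff_forall_hasSurjectiveModNGaloisRep W 3).mpr
    (ClassX4.towerSurj_three_of_surj_of_padicValRat_j_lt_three hX hsurj hlt)

end ClassLevel

/-! ### §3 The X4 end-state with the EXOTIC piece on the SIGNATURE rows only -/

section Signature

/-- **The two-arm EXOTIC hypothesis ⟺ the SHARP-signature EXOTIC hypothesis**: p14's EXOTIC piece
restricted to {(w), `v₃(j − 1728) ∈ {3, 0}`, ARM B} (`X4ExoticWildArms`) is equivalent to the same
statement on the rows with (w), `v₃(j − 1728) = 3`, Hauptmodul SIGNATURE, ARM B.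
[cite: Wuthrich2014, Lemma 20 (p. 399)] [cite: Maier2006, Table 4 (N = 3, 9) and §5] [cite: Elkies2006, §1] -/
theorem exotic_arms_iff_exotic_of_sharp_signature :
    (∀ (W : WeierstrassCurve ℚ) [W.IsElliptic] [W.IsGloballyMinimal],
        W.analyticRank = 0 → ClassX4 W 3 → Surj W 3 → SubW W 3 →
        (padicValRat 3 (W.j - 1728) = 3 ∨ padicValRat 3 (W.j - 1728) = 0) →
        (∀ q : ℕ, q.Prime → q ≠ 3 → padicValRat q W.j < 0 → (9 : ℤ) ∣ padicValRat q W.j) →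
        ¬ (∀ n : ℕ, W.HasSurjectiveModNGaloisRep (3 ^ n : ℕ)) → MissingUpperBoundAt W 3) ↔
    (∀ (W : WeierstrassCurve ℚ) [W.IsElliptic] [W.IsGloballyMinimal],
        W.analyticRank = 0 → ClassX4 W 3 → Surj W 3 → SubW W 3 →
        padicValRat 3 (W.j - 1728) = 3 →
        (∃ (V : ℕ) (c : ℤ), padicValRat 3 W.j = V ∧ (9 : ℤ) ∣ (W.j / 3 ^ V - c).num ∧
            ((V = 3 ∧ c % 9 = 8) ∨
             (6 ≤ V ∧ V % 3 = 0 ∧ (c % 9 = 1 ∨ c % 9 = 8)) ∨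
             (V = 7 ∧ (c % 9 = 2 ∨ c % 9 = 4)) ∨
             (8 ≤ V ∧ V % 3 ≠ 0 ∧ (c % 9 = 1 ∨ c % 9 = 8)))) →
        (∀ q : ℕ, q.Prime → q ≠ 3 → padicValRat q W.j < 0 → (9 : ℤ) ∣ padicValRat q W.j) →
        ¬ (∀ n : ℕ, W.HasSurjectiveModNGaloisRep (3 ^ n : ℕ)) → MissingUpperBoundAt W 3) := by
  haveI : Fact (Nat.Prime 3) := ⟨Nat.prime_three⟩
  constructor
  · intro h V _ _ hr hX hs hS h3 _ h9 hnot
    exact h V hr hX hs hS (Or.inl h3) h9 hnot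
  · intro h V _ _ hr hX hs hS _ h9 hnot
    obtain ⟨-, h3, hsig, -⟩ := ClassX4.exotic_signature_sharp_of_not_towerSurj_three hX hs hnot
    exact h V hr hX hs hS h3 hsig h9 hnot

/-- The same equivalence starting from p251574's UNRESTRICTED EXOTIC piece (`ord₃ j ≥ 0`, `¬ TypeG`,
tower fails ⟹ upper): p14's `exotic_iff_exotic_of_arms` followed by
`exotic_arms_iff_exotic_of_sharp_signature`. [cite: Wuthrich2014, Lemma 20 (p. 399)]
[cite: Maier2006, Table 4 (N = 3, 9) and §5] -/
theorem exotic_iff_exotic_of_sharp_signature :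
    (∀ (W : WeierstrassCurve ℚ) [W.IsElliptic] [W.IsGloballyMinimal],
        W.analyticRank = 0 → ClassX4 W 3 → Surj W 3 → 0 ≤ padicValRat 3 W.j → ¬ TypeG W 3 →
        ¬ (∀ n : ℕ, W.HasSurjectiveModNGaloisRep (3 ^ n : ℕ)) → MissingUpperBoundAt W 3) ↔
    (∀ (W : WeierstrassCurve ℚ) [W.IsElliptic] [W.IsGloballyMinimal],
        W.analyticRank = 0 → ClassX4 W 3 → Surj W 3 → SubW W 3 →
        padicValRat 3 (W.j - 1728) = 3 →
        (∃ (V : ℕ) (c : ℤ), padicValRat 3 W.j = V ∧ (9 : ℤ) ∣ (W.j / 3 ^ V - c).num ∧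
            ((V = 3 ∧ c % 9 = 8) ∨
             (6 ≤ V ∧ V % 3 = 0 ∧ (c % 9 = 1 ∨ c % 9 = 8)) ∨
             (V = 7 ∧ (c % 9 = 2 ∨ c % 9 = 4)) ∨
             (8 ≤ V ∧ V % 3 ≠ 0 ∧ (c % 9 = 1 ∨ c % 9 = 8)))) →
        (∀ q : ℕ, q.Prime → q ≠ 3 → padicValRat q W.j < 0 → (9 : ℤ) ∣ padicValRat q W.j) →
        ¬ (∀ n : ℕ, W.HasSurjectiveModNGaloisRep (3 ^ n : ℕ)) → MissingUpperBoundAt W 3) :=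
  exotic_iff_exotic_of_arms.trans exotic_arms_iff_exotic_of_sharp_signature

/-- **THE END-STATE OF CLASS X4 ON EIGHT NAMED FACTS with the EXOTIC piece on the SIGNATURE rows ONLY:
X4♯(unit-free) ⟺ LOWER ∧ EXOTIC((w) ∧ `v₃(j−1728) = 3` ∧ SIG ∧ no level-9 `j`-witness) ∧
TAM-DEFECT₂♭ ∧ ODD-SHA♭ ∧ MANIN♭** — n1011-p14's `…_exoticArms_noL20` (p264500) rewritten along
`exotic_arms_iff_exotic_of_sharp_signature`; supersedes p301713's `…_exoticHauptmodul_noL20` (which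
quantified over `v₃(j − 1728) ∈ {3, 0}` with a `= 0 ∨ SIG` clause). No named fact beyond the eight;
X4 stays CONSTRUCTION-SHAPED; nothing booked. [cite: Kato2004Asterisque, Thm. 14.5 (3) (p. 236), Thm. 17.4 (3) (p. 273)]
[cite: Delbourgo1998, Prop. 4 (p. 144)] [cite: Wuthrich2014, Lemma 20 (p. 399)] [cite: SilvermanAEC2009, Thm. X.4.14]
[cite: Kim2022StructureSelmer, Conj. 1.10 (PDF p. 8)] [cite: Miller2011LMS, Def. 1.1] [cite: Elkies2006, §1]
[cite: Maier2006, Table 4 (N = 3, 9) and §5] -/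
theorem x4SharpUnitFree_iff_lower_and_residues_sharp_exoticSig_noL20
    (hCT : exists_casselsTate_pairing (K := ℚ))
    (hKatoS : Kato2004.rankZero_padicValNat_sha_le_sub_localTamagawa_of_additive_potGood_of_imageContainsSL2)
    (hDel : Delbourgo1998.prop4_rankZero_pow_dvd_constantCoeff)
    (hGZK : rank_eq_analyticRank_of_analyticRank_le_one) (hmod : hasEntireLFunction_rat)
    (hmodD : nonempty_modularParametrizationData)
    (hKatoχ : Wuthrich2014.kato_halfEigenCharIdeal_dvd_cyclotomicPrime_of_surjective)
    (hK : Kato2004.charIdeal_dvd_padicLFunctionBranch_component_of_surjective) :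
    X4SharpUnitFree ↔
      (∀ (W : WeierstrassCurve ℚ) [W.IsElliptic] [W.IsGloballyMinimal] (p : ℕ) [Fact p.Prime],
          W.analyticRank = 0 → ClassX4 W p → Surj W p → MissingLowerBoundAt W p) ∧
      (∀ (W : WeierstrassCurve ℚ) [W.IsElliptic] [W.IsGloballyMinimal],
          W.analyticRank = 0 → ClassX4 W 3 → Surj W 3 → SubW W 3 →
          padicValRat 3 (W.j - 1728) = 3 →
          (∃ (V : ℕ) (c : ℤ), padicValRat 3 W.j = V ∧ (9 : ℤ) ∣ (W.j / 3 ^ V - c).num ∧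
              ((V = 3 ∧ c % 9 = 8) ∨
               (6 ≤ V ∧ V % 3 = 0 ∧ (c % 9 = 1 ∨ c % 9 = 8)) ∨
               (V = 7 ∧ (c % 9 = 2 ∨ c % 9 = 4)) ∨
               (8 ≤ V ∧ V % 3 ≠ 0 ∧ (c % 9 = 1 ∨ c % 9 = 8)))) →
          (∀ q : ℕ, q.Prime → q ≠ 3 → padicValRat q W.j < 0 → (9 : ℤ) ∣ padicValRat q W.j) →
          ¬ (∀ n : ℕ, W.HasSurjectiveModNGaloisRep (3 ^ n : ℕ)) → MissingUpperBoundAt W 3) ∧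
      (∀ (W : WeierstrassCurve ℚ) [W.IsElliptic] [W.IsGloballyMinimal] (p : ℕ) [Fact p.Prime],
          W.analyticRank = 0 → ClassX4 W p → Surj W p → 0 ≤ padicValRat p W.j →
          ¬ (TypeGOrd W p ∧ semistabilityIndex W p = 2) →
          padicValNat p ((W.baseChange ℚ_[p]).localTamagawaNumber ℤ_[p]) + 2 ≤
            padicValNat p W.tamagawaProduct →
          MissingUpperBoundAt W p) ∧
      (∀ (W : WeierstrassCurve ℚ) [W.IsElliptic] [W.IsGloballyMinimal] (p : ℕ) [Fact p.Prime],
          W.analyticRank = 0 → ClassX4 W p → Surj W p → 0 ≤ padicValRat p W.j →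
          ¬ (TypeGOrd W p ∧ semistabilityIndex W p = 2) →
          (∃ q : ℚ, shaAn W = (q : ℂ) ∧ Odd (padicValRat p q)) → MissingUpperBoundAt W p) ∧
      (∀ (W : WeierstrassCurve ℚ) [W.IsElliptic] [W.IsGloballyMinimal] (p : ℕ) [Fact p.Prime],
          W.analyticRank = 0 → ClassX4 W p → Surj W p → 0 ≤ padicValRat p W.j →
          ¬ (TypeGOrd W p ∧ semistabilityIndex W p = 2) →
          (∀ (N : ℕ) [NeZero N] (D : ModularParametrizationData W N), (p : ℤ) ∣ D.maninConstant) →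
          MissingUpperBoundAt W p) := by
  rw [x4SharpUnitFree_iff_lower_and_residues_sharp_exoticArms_noL20 hCT hKatoS hDel hGZK hmod hmodD
    hKatoχ hK, exotic_arms_iff_exotic_of_sharp_signature]

end Signature

/-! ### §4 The class-free dichotomy: `ρ̄_{E,3}` onto ⟹ tower, or wild with the sharp signature -/

section ClassFree

variable {W : WeierstrassCurve ℚ} [W.IsElliptic] [W.IsGloballyMinimal]

/-- **For EVERY (globally minimal) `E/ℚ` with `ρ̄_{E,3}` onto: either `ρ̄_{E,3ⁿ}` is onto for all
`n`, or `E` is additive and WILD at `3` with the sharp EXOTIC signature** (`v₃(j − 1728) = 3`,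
Hauptmodul SIGNATURE type, `9 ∣ ord_q j` at every potentially multiplicative prime `q`). Semistable
at `3`: Wuthrich 2014 Lemma 20 (tree theorem); additive: §2 with `E[3]` irreducible from surjectivity.
[cite: Wuthrich2014, Lemma 20 (p. 399)] [cite: SerreAbelianLadic1968, Ch. IV §3.4, Lemma 3 (IV-23)]
[cite: Maier2006, Table 4 (N = 3, 9) and §5] [cite: Elkies2006, §1] -/
theorem towerSurj_three_or_exotic_signature [Fact (Nat.Prime 3)] (hsurj : Surj W 3) :
    (∀ n : ℕ, W.HasSurjectiveModNGaloisRep (3 ^ n : ℕ)) ∨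
    (Addv W 3 ∧ SubW W 3 ∧ padicValRat 3 (W.j - 1728) = 3 ∧
      (∃ (V : ℕ) (c : ℤ), padicValRat 3 W.j = V ∧ (9 : ℤ) ∣ (W.j / 3 ^ V - c).num ∧
          ((V = 3 ∧ c % 9 = 8) ∨
           (6 ≤ V ∧ V % 3 = 0 ∧ (c % 9 = 1 ∨ c % 9 = 8)) ∨
           (V = 7 ∧ (c % 9 = 2 ∨ c % 9 = 4)) ∨
           (8 ≤ V ∧ V % 3 ≠ 0 ∧ (c % 9 = 1 ∨ c % 9 = 8)))) ∧
      ∀ q : ℕ, q.Prime → q ≠ 3 → padicValRat q W.j < 0 → (9 : ℤ) ∣ padicValRat q W.j) := by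
  by_cases htower : ∀ n : ℕ, W.HasSurjectiveModNGaloisRep (3 ^ n : ℕ)
  · exact Or.inl htower
  right
  by_cases hadd : Addv W 3
  · haveI : NeZero ((3 : ℕ) : ℚ) := ⟨by norm_num⟩
    have hirr : Irr W 3 := hasIrreducibleModPGaloisRep_of_hasSurjectiveModNGaloisRep W 3 hsurj
    have hX : ClassX4 W 3 := ⟨by decide, hadd, hirr⟩
    exact ⟨hadd, ClassX4.exotic_signature_sharp_of_not_towerSurj_three hX hsurj htower⟩
  · exfalso
    have hred : W.HasGoodReductionAtPrime 3 ∨ W.HasMultiplicativeReductionAtPrime 3 := by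
      unfold Addv at hadd
      tauto
    exact htower (Wuthrich2014.lemma20_surjective_threeAdic_of_semistable_holds W hred hsurj)

/-- **Corollary: `ρ̄_{E,3}` onto and `v₃(j(E) − 1728) ≠ 3` ⟹ `ρ̄_{E,3ⁿ}` onto for every `n`** — for
every globally minimal `E/ℚ`, any reduction type at `3` (no class hypothesis; on X4 rows this is
n1011-p14's `ClassX4.towerSurj_three_of_surj_of_padicValRat_j_sub_ne`, p268581).
[cite: Wuthrich2014, Lemma 20 (p. 399)] [cite: SerreAbelianLadic1968, Ch. IV §3.4, Lemma 3 (IV-23)] -/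
theorem towerSurj_three_of_surj_of_padicValRat_j_sub_1728_ne_three [Fact (Nat.Prime 3)]
    (hsurj : Surj W 3) (hne : padicValRat 3 (W.j - 1728) ≠ 3) (n : ℕ) :
    W.HasSurjectiveModNGaloisRep (3 ^ n : ℕ) := by
  rcases towerSurj_three_or_exotic_signature hsurj with h | ⟨-, -, h3, -⟩
  · exact h n
  · exact absurd h3 hne

/-- **Kato's (12.5.2) at `3`** for every globally minimal `E/ℚ` with `ρ̄_{E,3}` onto and
`v₃(j − 1728) ≠ 3`. [cite: Kato2004Asterisque, (12.5.2) (p. 222)] [cite: Wuthrich2014, Lemma 20 (p. 399)] -/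
theorem imageContainsSL2_three_of_surj_of_padicValRat_j_sub_1728_ne_three [Fact (Nat.Prime 3)]
    (hsurj : Surj W 3) (hne : padicValRat 3 (W.j - 1728) ≠ 3) : Kato2004.ImageContainsSL2 W 3 :=
  (Kato2004.imageContainsSL2_iff_forall_hasSurjectiveModNGaloisRep W 3).mpr
    (towerSurj_three_of_surj_of_padicValRat_j_sub_1728_ne_three hsurj hne)

end ClassFree

end Summit.BirchSwinnertonDyer.Rank1Residual.Additive
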